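import Summits.QuantumFields.BalabanUV.T4Continuum.Spine.NE9.DirectPairingEnd
import Summits.QuantumFields.BalabanUV.T4Continuum.Spine.NE9.DirectPairingWindow
import Summits.QuantumFields.BalabanUV.T4Continuum.Spine.NE9.DirectPairingUVTail

/-!
# T⁴ programme, spine estimate NE9 — THE E-SIDE END WITH THE WINDOW AND THE UV TAILS DISCHARGED BY NAME, the non-summable King window for the
# slow profile, and ONE window for finitely many profiles — census items C42 ∕ C43 (sequel) of cell `pub-balaban-gaps`, seat ne9 (gen 12)

Cell `pub-balaban-gaps` (YM blitz G2, seat ne9, unit `pub-balaban-gaps-ne9-g12`; record `run/shared/lean/pub/pub-balaban-gaps/ne/NE9.md` §5 rows C42 ∕ C43).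
Sequel of `DirectPairingEnd` (C42: the `summable` fields of `RelWeightBound` ∕ `ShellWeightBound` are idle for King and incompatible with an adapted window; C43:
`king_end_of_window`), importing this seat's gen-11 files `DirectPairingWindow` (C40) and `DirectPairingUVTail` (C41) so that the window and the UV tails are
discharged BY NAME.  NO definition; nothing of Bałaban's asserted.

* §1 `kingWindow_budget_not_summable` (C42's companion): for `b_j = 1∕log(j+2)`, `0 < r₀ < 1`, `Λ > 1`, `V > 0` and any cap, King's adapted window EXISTS
  (`DirectPairingWindow.exists_kingWindow`: deviation window sum AND bad-class budget `→ 0`) and EVERY window passing that profile has a NON-summable budget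
  (`DirectPairingEnd.summableBudget_window_not_tendsto'`).
* §2 `king_end_of_profile` (C43, gen 11's door (a) literally): from ONE profile `b → 0`, the printed size data, NE7b's rate `0 ≤ r₀ < 1` with `0 ≤ V < 1`, a cap
  `cap K → ∞`, `cap K ≤ K`, the non-E-side pieces `w, u', s', s₂ → 0`, and PRODUCERS delivering — for EVERY window `m ≤ cap` (the window is King's to choose) — the
  dictionary, a bad class of relative weight `≤ V·r₀^{m K}` and a `ReindexedBudget` whose slots carry C39's crossover majorant (`r`), C41's UV tails + `u'` (`u`) and C40's
  window sum + `s'` (`s`): Cauchy + uniform convergence — `exists_kingWindow` → `tendsto_badBudget_of_window` ∕ `uvTail_tendsto` ∕ `uvTailR_tendsto` →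
  `DirectPairingEnd.king_end_of_window`, all BY NAME.
* §3 `exists_kingWindow_finset` (gen 11's door (b)): finitely many profiles `bs i → 0`, `i ∈ s`, share ONE adapted window (the sum profile dominates each).

HONEST FRAMING: bookkeeping for rung (B)+1 on ONE FIXED finite four-torus; elementary real analysis on hypothesis SHAPES; NE9 NOT PRINTED ∕ NOT PROVED; spine PROVED
0∕9 unchanged; NOT UV stability, NOT the continuum limit, NOT infinite volume, NOT a mass gap, NOT Clay.  HONEST DEPENDENCY: continuum YM on T⁴ ⇐ BetaPertH ∧ nine
spine estimates (0∕9 proved); BetaPertH ⇐ (D1) ∧ (D4) ∧ CAP+tail.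

References (TYPES only): [King1986] = C. King, Commun. Math. Phys. **102** (1986) 649–677, Thm 3.4 (3.9) p. 656, p. 657; [Balaban1988Convergent] = T. Bałaban,
Commun. Math. Phys. **119** (1988) 243–285, Thm 2 (2.43)–(2.44) p. 263.
-/

namespace Summit.QuantumFields.BalabanUV.T4Continuum.NE9.DirectPairingEndWindow

open scoped BigOperators
open Finset Filter Topology
open Literature.MathematicalPhysics.QuantumFieldTheory.Balaban1983to89
open T4CauchySum (genFun genFunLim)
open T4MatchingClosure (ReindexedBudget)
open Summit.QuantumFields.BalabanUV.T4Continuum.NE9.DirectPairingEnd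
  (logProfile_admissible summableBudget_window_not_tendsto' king_end_of_window)

/-! ## §1 King's window for the slow profile exists and is never summable -/

/-- **KING'S ADAPTED WINDOW FOR `b_j = 1∕log(j+2)` EXISTS AND HAS A NON-SUMMABLE BAD-CLASS BUDGET.**  For `0 < r₀ < 1`, `Λ > 1`, `V > 0` and any cap `cap K → ∞`,
`cap K ≤ K`: there is a window `m K → ∞`, `m K ≤ cap K`, along which the deviation window sum AND the bad-class budget `V·r₀^{K−(K−m K)}` TEND TO ZERO
(`DirectPairingWindow.exists_kingWindow`), and for EVERY window `m K ≤ K` passing the profile the budget is NOT summable (`DirectPairingEnd.summableBudget_window_not_tendsto'`)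
— the `summable` field of `RelWeightBound` is not available to King's organisation. [folklore] -/
theorem kingWindow_budget_not_summable {r₀ Λ V : ℝ} (h0 : 0 < r₀) (h1 : r₀ < 1) (hΛ : 1 < Λ) (hV : 0 < V)
    {cap : ℕ → ℕ} (hcap : Tendsto cap atTop atTop) (hcapK : ∀ K, cap K ≤ K) :
    (∃ m : ℕ → ℕ, (∀ K, m K ≤ cap K) ∧ Tendsto m atTop atTop ∧
      Tendsto (fun K => ∑ j ∈ Icc (K - m K) K, 1 / Real.log ((j : ℝ) + 2) * Λ ^ (K - j)) atTop (𝓝 0) ∧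
      Tendsto (fun K => V * r₀ ^ (K - (K - m K))) atTop (𝓝 0)) ∧
    ∀ m : ℕ → ℕ, (∀ K, m K ≤ K) →
      Tendsto (fun K => ∑ j ∈ Icc (K - m K) K, 1 / Real.log ((j : ℝ) + 2) * Λ ^ (K - j)) atTop (𝓝 0) →
        ¬ Summable (fun K => V * r₀ ^ (K - (K - m K))) := by
  refine ⟨DirectPairingWindow.exists_kingWindow (Λ := Λ) (V := V) logProfile_admissible.2 h0.le h1 hcap hcapK,
    fun m hmK hwin hS => ?_⟩
  have hS' : Summable (fun K => r₀ ^ m K) := by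
    refine (hS.mul_left V⁻¹).congr fun K => ?_
    rw [DirectPairingWindow.sub_sub_window (hmK K), ← mul_assoc, inv_mul_cancel₀ hV.ne', one_mul]
  exact summableBudget_window_not_tendsto' h0 h1 hΛ hmK hS' hwin

/-! ## §2 The E-side END with the window and the UV tails discharged by name -/

section End

variable {ι : Type*} [DecidableEq ι] {l₀ vol : ℝ} {Z : ℕ → ℝ → ℝ}
  {E₁ a Λ b₀ β' R₁ r₀ V Cw : ℝ} {κ₀ : ℕ} {g : ℕ → ℝ} {gs : ℕ → ℕ → ℝ} {b w u' s' s₂ : ℕ → ℝ} {cap : ℕ → ℕ}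

/-- **THE E-SIDE OF NE9-AS-CONSUMED ON THE KING ROUTE, END TO END** (gen 11's door (a), literally).  INPUT from the E-side: ONE nonnegative scale profile
`b_j → 0` (§17 rows 1–5 of `NE9.md`).  PRINTED data: the one-run size branch `E₁aⁿ` ∕ `R₁ g_j^{κ₀}` ([Balaban1988Convergent] Thm 2 (2.43)∕(2.44), a SHAPE) under the
lower half of (0.31), `κ₀ > 2`.  DESIGN data: NE7b's bad-class rate `0 ≤ r₀ < 1` with `0 ≤ V < 1`, a window cap `cap K → ∞`, `cap K ≤ K` (the geometric rate-only kinds'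
linear cap), and the NON-E-side rate pieces `w` (last step ∕ weights), `u'` (NE-R1 (γ) proper), `s'` (the other kinds' deviations), `s₂` (NE-R1 (β)) `→ 0`.  PRODUCERS
(owner T4-DAG; hypothesis `hprod`): for EVERY window `m ≤ cap`, the dictionary per pair `(K, K + n)`, a bad class of relative weight `≤ V·r₀^{m K}`, and the cell's
`ReindexedBudget` whose slots carry LITERALLY `r K` = C39's King crossover majorant, `u K = E₁a^{K+1}∕(1−a) + Σ_{i≥K+1} R₁(b₀ i)^{−κ₀∕2} + u' K` (C41's n-uniform
UV tails), `s K = Cw·Σ_{j=K−m K}^{K} b_jΛ^{K−j} + s' K` (C40), and `s₂`.  CONCLUSION: Cauchy generating functions with uniform convergence on the `l₀`-ball —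
`DirectPairingWindow.exists_kingWindow` (choose `m` adapted to `b`) → `tendsto_badBudget_of_window`, `DirectPairingUVTail.uvTail_tendsto` ∕ `uvTailR_tendsto` →
`DirectPairingEnd.king_end_of_window`, BY NAME.  CONDITIONAL kernel theorem on hypothesis SHAPES. [cite: King1986, Thm 3.4 (3.9) p. 656, p. 657] [folklore] -/
theorem king_end_of_profile (hvol : 0 < vol) (hl₀ : 0 ≤ l₀)
    (hb0 : ∀ j, 0 ≤ b j) (hb : Tendsto b atTop (𝓝 0)) (hE₁ : 0 ≤ E₁) (ha0 : 0 ≤ a) (ha1 : a < 1) (hΛ : 0 ≤ Λ)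
    (hb₀ : 0 < b₀) (h031 : ∀ K, Step.Discrete031 b₀ β' K (g K) (gs K)) (hgs : ∀ K k, k ≤ K → 0 ≤ gs K k)
    (hR₁ : 0 ≤ R₁) (hκ : 2 < κ₀)
    (hr₀0 : 0 ≤ r₀) (hr₀1 : r₀ < 1) (hV0 : 0 ≤ V) (hV1 : V < 1) (hcap : Tendsto cap atTop atTop) (hcapK : ∀ K, cap K ≤ K)
    (hw : Tendsto w atTop (𝓝 0)) (hu' : Tendsto u' atTop (𝓝 0)) (hs' : Tendsto s' atTop (𝓝 0))
    (hs₂ : Tendsto s₂ atTop (𝓝 0))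
    (hprod : ∀ m : ℕ → ℕ, (∀ K, m K ≤ cap K) →
      ∃ (T : ℕ → ℕ → Finset ι) (A B : ℕ → ℕ → ℝ → ι → ℝ) (Bad : ℕ → ℕ → ℝ → Finset ι)
        (Cc Rr CcRec RrRec : ℕ → ℕ → ℝ → ι → ℝ) (ν c₀ : ℕ → ℕ → ℝ),
        (∀ n K t, |t| ≤ l₀ → Z K t = ∑ τ ∈ T n K, A n K t τ) ∧
        (∀ n K t, |t| ≤ l₀ → Z (K + n) t = ∑ τ ∈ T n K, B n K t τ) ∧
        (∀ n K t, |t| ≤ l₀ → 0 < ∑ τ ∈ T n K, A n K t τ) ∧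
        (∀ n K t, |t| ≤ l₀ → Bad n K t ⊆ T n K) ∧
        (∀ n K t, |t| ≤ l₀ → ∀ τ ∈ T n K, 0 ≤ A n K t τ) ∧
        (∀ n K t, |t| ≤ l₀ → ∀ τ ∈ T n K, 0 ≤ B n K t τ) ∧
        (∀ n K t, |t| ≤ l₀ → ∑ τ ∈ Bad n K t, A n K t τ ≤ V * r₀ ^ m K * ∑ τ ∈ T n K, A n K t τ) ∧
        (∀ n K t, |t| ≤ l₀ → ∑ τ ∈ Bad n K t, B n K t τ ≤ V * r₀ ^ m K * ∑ τ ∈ T n K, B n K t τ) ∧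
        ∀ n, ReindexedBudget l₀ vol (T n) (A n) (B n) (Bad n) (Cc n) (Rr n) (CcRec n) (RrRec n) (ν n)
          (fun K => E₁ * a ^ (K + 1) / (1 - a)
            + (∑' i : ℕ, R₁ * (b₀ * (((i + (K + 1) : ℕ) : ℝ)))⁻¹ ^ ((κ₀ : ℝ) / 2)) + u' K)
          s₂ (c₀ n)
          (fun K => (∑ p ∈ antidiagonal K, min (E₁ * a ^ p.2) (b p.1 * Λ ^ p.2))
            + (∑ p ∈ antidiagonal K, min (R₁ * gs K p.1 ^ κ₀) (b p.1 * Λ ^ p.2)) + w K)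
          (fun K => Cw * ∑ j ∈ Icc (K - m K) K, b j * Λ ^ (K - j) + s' K)) :
    (∀ t : ℝ, |t| ≤ l₀ → CauchySeq fun K => genFun Z K t) ∧
      TendstoUniformlyOn (fun K t => genFun Z K t) (genFunLim Z) atTop {t | |t| ≤ l₀} := by
  -- C40: choose the window ADAPTED to the profile, within the cap
  obtain ⟨m, hmc, hmt, hwin, -⟩ :=
    DirectPairingWindow.exists_kingWindow (Λ := Λ) (V := V) hb hr₀0 hr₀1 hcap hcapK
  obtain ⟨T, A, B, Bad, Cc, Rr, CcRec, RrRec, ν, c₀, hZA, hZB, hpos, hBad, hA, hB, hbadA, hbadB, hRB⟩ := hprod m hmc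
  refine king_end_of_window (m := m) hvol hl₀ hb0 hb hE₁ ha0 ha1 hΛ hb₀ h031 hgs hR₁ hκ (fun K => ?_) ?_ hwin hw ?_ hs' hs₂
    T A B Bad Cc Rr CcRec RrRec ν c₀ hZA hZB hpos hBad hA hB hbadA hbadB hRB
  · -- `V·r₀^{m K} ≤ V < 1`
    exact (mul_le_of_le_one_right hV0 (pow_le_one₀ hr₀0 hr₀1.le)).trans_lt hV1
  · -- the bad-class budget along the window (NOT summable in general, §1)
    exact DirectPairingWindow.tendsto_badBudget_of_window hr₀0 hr₀1 hmt
  · -- the UV slot: C41's printed tails + NE-R1 (γ) proper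
    simpa using ((DirectPairingUVTail.uvTail_tendsto (E₁ := E₁) ha0 ha1).add
      (DirectPairingUVTail.uvTailR_tendsto (b₀ := b₀) (R₁ := R₁) (κ₀ := κ₀))).add hu'

end End

/-! ## §3 Finitely many profiles share one adapted window -/

/-- **ONE KING WINDOW FOR FINITELY MANY PROFILES.**  Finitely many nonnegative profiles `bs i → 0` (`i ∈ s`: the E-kind and whichever other rate-only kinds carry a
coupling-history dependence in King's qualitative currency), `Λ ≥ 0`, NE7b's `0 ≤ r₀ < 1`, `V`, and a cap `cap K → ∞`, `cap K ≤ K`: there is ONE window `m K → ∞`,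
`m K ≤ cap K`, along which EVERY profile's deviation window sum AND the bad-class budget tend to zero — `DirectPairingWindow.exists_kingWindow` on the sum profile
`Σ_{i∈s} bs i`, which dominates each. [folklore] -/
theorem exists_kingWindow_finset {α : Type*} (s : Finset α) {bs : α → ℕ → ℝ} {Λ r₀ V : ℝ} {cap : ℕ → ℕ}
    (h0 : ∀ i ∈ s, ∀ j, 0 ≤ bs i j) (hb : ∀ i ∈ s, Tendsto (bs i) atTop (𝓝 0)) (hΛ : 0 ≤ Λ)
    (hr₀0 : 0 ≤ r₀) (hr₀1 : r₀ < 1) (hcap : Tendsto cap atTop atTop) (hcapK : ∀ K, cap K ≤ K) :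
    ∃ m : ℕ → ℕ, (∀ K, m K ≤ cap K) ∧ Tendsto m atTop atTop ∧
      (∀ i ∈ s, Tendsto (fun K => ∑ j ∈ Icc (K - m K) K, bs i j * Λ ^ (K - j)) atTop (𝓝 0)) ∧
      Tendsto (fun K => V * r₀ ^ (K - (K - m K))) atTop (𝓝 0) := by
  have hB : Tendsto (fun j => ∑ i ∈ s, bs i j) atTop (𝓝 0) := by
    simpa using tendsto_finsetSum s fun i hi => hb i hi
  obtain ⟨m, hmc, hmt, hwin, hbad⟩ :=
    DirectPairingWindow.exists_kingWindow (Λ := Λ) (V := V) hB hr₀0 hr₀1 hcap hcapK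
  refine ⟨m, hmc, hmt, fun i hi => ?_, hbad⟩
  refine squeeze_zero (fun K => sum_nonneg fun j _ => mul_nonneg (h0 i hi j) (pow_nonneg hΛ _)) (fun K => ?_) hwin
  exact sum_le_sum fun j _ => mul_le_mul_of_nonneg_right
    (single_le_sum (f := fun i => bs i j) (fun i' hi' => h0 i' hi' j) hi) (pow_nonneg hΛ _)

end Summit.QuantumFields.BalabanUV.T4Continuum.NE9.DirectPairingEndWindow
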